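import Summits.RiemannHypothesis.RiemannHypothesis.Theorems.HandoffLadderTheoremRungs
import Summits.RiemannHypothesis.RiemannHypothesis.Theorems.SemilocalNegCertEmpty
import Summits.RiemannHypothesis.RiemannHypothesis.Theorems.SemilocalNegCert05575
import Summits.RiemannHypothesis.RiemannHypothesis.Theorems.SemilocalNegCertTwoThree
import Summits.RiemannHypothesis.RiemannHypothesis.Theorems.SemilocalNegCertTwoThreeFive
import Summits.RiemannHypothesis.RiemannHypothesis.Theorems.SemilocalNegCertSeven
import Summits.RiemannHypothesis.RiemannHypothesis.Theorems.SemilocalNegCertEleven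
import HarnessLib

/-!
# HANDOFF — the RH-free UPPER clauses of the handoff card as THEOREMS for `q ≤ 13` (cell rh-explicit, TRACK «HANDOFF», seat theory-2)

HONEST FRAMING. Nothing here bears on the truth of RH. The per-prime handoff card (HANDOFF-STATEMENT §H.4 / `HANDOFF-CARD.md`) has,
next to the LOWER clause `H(q)` (certified / theorem rungs), an RH-free UPPER clause «the OLD form `{p < q}` IS negative somewhere on
the window of `q`», i.e. `a*(S_q) < (log q⁺)/2`, equivalently `0 < D_q((log q⁺)/2)`, equivalently the load `r(q) > 0` — the handoff is a
GENUINE rescue, never vacuous. The card quotes it as CERTIFIED DATA (cc6 / cc-s2-1 section walls, `5 ≤ q ≤ 73`). For `q = 2, 3, 5, 7, 11, 13`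
it is in fact a TREE THEOREM, by the cc-s2-4 kernel wall certificates (`SemilocalNegCert*.lean`: Markov-witness polynomials × indicator with
kernel-checked negative values): `a*(∅) ≤ 3/8`, `a*({2}) ≤ 223/400`, `a*({2,3}) ≤ 163/200`, `a*({2,3,5}) ≤ 197/200`, `a*({2,3,5,7}) ≤ 61/50`,
`a*({2,…,11}) ≤ 13/10`. This file does the bookkeeping once:

* §1 `primesBelow` / `nextPrime` arithmetic for `q ≤ 13`;
* §2 **`a*(S_q) < (log q⁺)/2`** for `q = 2, 3, 5, 7, 11, 13` (`weilSemilocalThreshold_primesBelow_lt_*`);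
* §3 consequences in the typed currencies of §H.15: `0 < D_q((log q⁺)/2)`, **`0 < r(q)`**, `¬ WeilSemilocalPositivityOn S_q ((log q⁺)/2)`;
  with the theorem rungs of `HandoffLadderTheoremRungs`: **`0 < r(2) ≤ 1` and `0 < r(3) ≤ 1` are THEOREMS** (the first two handoffs are
  genuine AND successful, in the kernel); TWO-SIDED wall offsets `0 ≤ δ*(3) ≤ 223/400 − (log 3)/2` (< 0.0083; DATA 0.0080),
  `0 ≤ δ*(5) ≤ 163/200 − (log 5)/2` (< 0.0103; DATA 0.0025), and the upper bounds `δ*(7) ≤ 197/200 − (log 7)/2`, `δ*(11) ≤ 61/50 − (log 11)/2`,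
  `δ*(13) ≤ 13/10 − (log 13)/2` (loose by ×10–40 against the A4 DATA; the sizes are A4's, only the signs and these bounds are theorems).

References: H. Yoshida, Adv. Stud. Pure Math. 21 (1992) Prop. 6 (p. 320) (`Yoshida1992HermitianForms`); A. Connes, C. Consani,
*Spectral triples and ζ-cycles*, Enseign. Math. 69 (2023) 93–148 = arXiv:2106.01715, §2
(`ConnesConsani2023`, semi-local forms and their thresholds); the certificates are the tree's (cc-s2-4, `SemilocalNegCert*`).
-/

set_option linter.dupNamespace false  -- the mandated namespace repeats `RiemannHypothesis`

noncomputable section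

open Set Literature.NumberTheory.LFunctions
open Summit.RiemannHypothesis.RiemannHypothesis.Theorems
open Summit.RiemannHypothesis.RiemannHypothesis.Theorems.Handoff (ConsecutivePrimes)
open Summit.RiemannHypothesis.RiemannHypothesis.Theorems.HandoffDecomposition
open Summit.RiemannHypothesis.RiemannHypothesis.Theorems.HandoffSemilocalEnergy
open Summit.RiemannHypothesis.RiemannHypothesis.Theorems.HandoffLoadCeiling
open Summit.RiemannHypothesis.RiemannHypothesis.Theorems.HandoffMarginLaw
open Summit.RiemannHypothesis.RiemannHypothesis.Theorems.HandoffLadderTheoremRungs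
open Summit.RiemannHypothesis.RiemannHypothesis.Theorems.MotivicDoor.SemilocalThreshold
open Summit.RiemannHypothesis.RiemannHypothesis.Theorems.SemilocalPolyWitness

namespace Summit.RiemannHypothesis.RiemannHypothesis.Theorems.HandoffUpperClauses

variable {q p : ℕ}

/-! ## §1  Arithmetic of the first six windows -/

/-- `nextPrime q = p` when `p` is a prime above `q` with no prime strictly between. [folklore] -/
theorem nextPrime_eq (hp : p.Prime) (hqp : q < p) (h : ∀ m : ℕ, q < m → m < p → ¬ m.Prime) : nextPrime q = p := by
  refine le_antisymm (nextPrime_le hp hqp) ?_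
  by_contra hlt
  exact h _ (lt_nextPrime q) (not_le.1 hlt) (nextPrime_prime q)

/-- `nextPrime 7 = 11`. [folklore] -/
theorem nextPrime_seven : nextPrime 7 = 11 :=
  nextPrime_eq (by norm_num) (by norm_num) (fun m h1 h2 ↦ by interval_cases m <;> decide)

/-- `nextPrime 11 = 13`. [folklore] -/
theorem nextPrime_eleven : nextPrime 11 = 13 :=
  nextPrime_eq (by norm_num) (by norm_num) (fun m h1 h2 ↦ by interval_cases m; decide)

/-- `nextPrime 13 = 17`. [folklore] -/
theorem nextPrime_thirteen : nextPrime 13 = 17 :=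
  nextPrime_eq (by norm_num) (by norm_num) (fun m h1 h2 ↦ by interval_cases m <;> decide)

/-- `(7, 11)` is a consecutive-prime pair. [folklore] -/
theorem consecutivePrimes_seven_eleven : ConsecutivePrimes 7 11 := by
  have h := consecutivePrimes_nextPrime (show Nat.Prime 7 by norm_num)
  rwa [nextPrime_seven] at h

/-- `(11, 13)` is a consecutive-prime pair. [folklore] -/
theorem consecutivePrimes_eleven_thirteen : ConsecutivePrimes 11 13 := by
  have h := consecutivePrimes_nextPrime (show Nat.Prime 11 by norm_num)
  rwa [nextPrime_eleven] at h

/-- `(13, 17)` is a consecutive-prime pair. [folklore] -/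
theorem consecutivePrimes_thirteen_seventeen : ConsecutivePrimes 13 17 := by
  have h := consecutivePrimes_nextPrime (show Nat.Prime 13 by norm_num)
  rwa [nextPrime_thirteen] at h

/-- `{p < 2} = ∅`. [folklore] -/
theorem primesBelow_two : Nat.primesBelow 2 = ∅ := by decide

/-- `{p < 3} = {2}`. [folklore] -/
theorem primesBelow_three : Nat.primesBelow 3 = {2} := by decide

/-- `{p < 7} = {2, 3, 5}`. [folklore] -/
theorem primesBelow_seven : Nat.primesBelow 7 = {2, 3, 5} := by decide

/-- `{p < 11} = {2, 3, 5, 7}`. [folklore] -/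
theorem primesBelow_eleven : Nat.primesBelow 11 = {2, 3, 5, 7} := by decide

/-- `{p < 13} = {2, 3, 5, 7, 11}`. [folklore] -/
theorem primesBelow_thirteen : Nat.primesBelow 13 = {2, 3, 5, 7, 11} := by decide

/-! ## §2  The upper clauses `a*(S_q) < (log q⁺)/2`, `q = 2, 3, 5, 7, 11, 13` -/

/-- **q = 2**: `a*(∅) < (log 3)/2` — the archimedean(+polar) form alone dies before `3` enters (tree `a*(∅) ≤ 3/8`). [cite: Yoshida1992HermitianForms, Prop. 6 (p. 320); tree certificate `SemilocalNegCertEmpty`] -/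
theorem weilSemilocalThreshold_primesBelow_two_lt : weilSemilocalThreshold (Nat.primesBelow 2) < Real.log 3 / 2 := by
  rw [primesBelow_two]
  exact weilSemilocalThreshold_empty_lt_log_three_half

/-- **q = 3**: `a*({2}) < (log 5)/2` (tree `a*({2}) ≤ 223/400 = 0.5575`; `(log 5)/2 > log 2 > 0.69`). [cite: Yoshida1992HermitianForms, Prop. 6 (p. 320); tree certificate `SemilocalNegCert05575`] -/
theorem weilSemilocalThreshold_primesBelow_three_lt : weilSemilocalThreshold (Nat.primesBelow 3) < Real.log 5 / 2 := by
  rw [primesBelow_three]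
  have h := weilSemilocalThreshold_two_le_05575
  push_cast at h
  have h2 := Real.log_two_gt_d9
  have h45 : Real.log 4 < Real.log 5 := Real.log_lt_log (by norm_num) (by norm_num)
  rw [show (4 : ℝ) = 2 ^ 2 by norm_num, Real.log_pow] at h45
  push_cast at h45
  linarith

/-- **q = 5**: `a*({2,3}) < (log 7)/2` (tree). [cite: Yoshida1992HermitianForms, Prop. 6 (p. 320); tree certificate `SemilocalNegCertTwoThree`] -/
theorem weilSemilocalThreshold_primesBelow_five_lt : weilSemilocalThreshold (Nat.primesBelow 5) < Real.log 7 / 2 := by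
  rw [primesBelow_five]
  exact weilSemilocalThreshold_twoThree_lt_log_seven_half

/-- **q = 7**: `a*({2,3,5}) < (log 11)/2` (tree `< (log 8)/2`). [cite: Yoshida1992HermitianForms, Prop. 6 (p. 320); tree certificate `SemilocalNegCertTwoThreeFive`] -/
theorem weilSemilocalThreshold_primesBelow_seven_lt : weilSemilocalThreshold (Nat.primesBelow 7) < Real.log 11 / 2 := by
  rw [primesBelow_seven]
  have h := weilSemilocalThreshold_twoThreeFive_lt_log_eight_half
  have h2 : Real.log 8 ≤ Real.log 11 := Real.log_le_log (by norm_num) (by norm_num)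
  linarith

/-- **q = 11**: `a*({2,3,5,7}) < (log 13)/2` (tree). [cite: Yoshida1992HermitianForms, Prop. 6 (p. 320); tree certificate `SemilocalNegCertSeven`] -/
theorem weilSemilocalThreshold_primesBelow_eleven_lt : weilSemilocalThreshold (Nat.primesBelow 11) < Real.log 13 / 2 := by
  rw [primesBelow_eleven]
  exact weilSemilocalThreshold_uptoSeven_lt_log_thirteen_half

/-- **q = 13**: `a*({2,…,11}) < (log 17)/2` (tree `< (log 16)/2`). [cite: Yoshida1992HermitianForms, Prop. 6 (p. 320); tree certificate `SemilocalNegCertEleven`] -/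
theorem weilSemilocalThreshold_primesBelow_thirteen_lt : weilSemilocalThreshold (Nat.primesBelow 13) < Real.log 17 / 2 := by
  rw [primesBelow_thirteen]
  have h := weilSemilocalThreshold_uptoEleven_lt_log_sixteen_half
  have h2 : Real.log 16 ≤ Real.log 17 := Real.log_le_log (by norm_num) (by norm_num)
  linarith

/-! ## §3  Consequences: positive loads, aggregate deficits, non-vacuity; two-sided offsets -/

/-- **`0 < r(2)`** — with `r(2) ≤ 1` (`handoffLoad_two_three_le_one`): the first handoff is a genuine and successful rescue, in the kernel. [this track] -/
theorem handoffLoad_two_three_pos : 0 < handoffLoad 2 3 :=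
  (handoffLoad_pos_iff consecutivePrimes_two_three).2 weilSemilocalThreshold_primesBelow_two_lt

/-- **`0 < r(3)`** — with `r(3) ≤ 1` (`handoffLoad_three_five_le_one`). [this track] -/
theorem handoffLoad_three_five_pos : 0 < handoffLoad 3 5 :=
  (handoffLoad_pos_iff consecutivePrimes_three_five).2 weilSemilocalThreshold_primesBelow_three_lt

/-- **`0 < r(5)`** (RH-free; `r(5) ≤ 1` is `H(5)`'s consequence, certified numerically, not a theorem). [this track] -/
theorem handoffLoad_five_seven_pos : 0 < handoffLoad 5 7 :=
  (handoffLoad_pos_iff consecutivePrimes_five_seven).2 weilSemilocalThreshold_primesBelow_five_lt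

/-- **`0 < r(7)`**. [this track] -/
theorem handoffLoad_seven_eleven_pos : 0 < handoffLoad 7 11 :=
  (handoffLoad_pos_iff consecutivePrimes_seven_eleven).2 weilSemilocalThreshold_primesBelow_seven_lt

/-- **`0 < r(11)`**. [this track] -/
theorem handoffLoad_eleven_thirteen_pos : 0 < handoffLoad 11 13 :=
  (handoffLoad_pos_iff consecutivePrimes_eleven_thirteen).2 weilSemilocalThreshold_primesBelow_eleven_lt

/-- **`0 < r(13)`**. [this track] -/
theorem handoffLoad_thirteen_seventeen_pos : 0 < handoffLoad 13 17 :=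
  (handoffLoad_pos_iff consecutivePrimes_thirteen_seventeen).2 weilSemilocalThreshold_primesBelow_thirteen_lt

/-- **`0 < r(2) ≤ 1` and `0 < r(3) ≤ 1`**: both clauses of the first two windows are THEOREMS (DATA r = 0.878, 0.972). [this track] -/
theorem handoffLoad_mem_Ioc_two_three : handoffLoad 2 3 ∈ Ioc (0 : ℝ) 1 ∧ handoffLoad 3 5 ∈ Ioc (0 : ℝ) 1 :=
  ⟨⟨handoffLoad_two_three_pos, handoffLoad_two_three_le_one⟩, ⟨handoffLoad_three_five_pos, handoffLoad_three_five_le_one⟩⟩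

/-- The aggregate deficits at the first six window ends are STRICTLY positive: `0 < D_q((log q⁺)/2)`, `q = 2, 3, 5, 7, 11, 13`. [this track] -/
theorem aggregateDeficit_pos_upto_thirteen :
    0 < aggregateDeficit 2 (Real.log 3 / 2) ∧ 0 < aggregateDeficit 3 (Real.log 5 / 2) ∧
      0 < aggregateDeficit 5 (Real.log 7 / 2) ∧ 0 < aggregateDeficit 7 (Real.log 11 / 2) ∧
        0 < aggregateDeficit 11 (Real.log 13 / 2) ∧ 0 < aggregateDeficit 13 (Real.log 17 / 2) :=
  ⟨aggregateDeficit_pos_iff.2 weilSemilocalThreshold_primesBelow_two_lt,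
    aggregateDeficit_pos_iff.2 weilSemilocalThreshold_primesBelow_three_lt,
    aggregateDeficit_pos_iff.2 weilSemilocalThreshold_primesBelow_five_lt,
    aggregateDeficit_pos_iff.2 weilSemilocalThreshold_primesBelow_seven_lt,
    aggregateDeficit_pos_iff.2 weilSemilocalThreshold_primesBelow_eleven_lt,
    aggregateDeficit_pos_iff.2 weilSemilocalThreshold_primesBelow_thirteen_lt⟩

/-- **Non-vacuity of the handoff**: for `q = 2, 3, 5, 7, 11, 13` the OLD form `{p < q}` is NOT non-negative on the window end of `q` —
some test function supported in `[−(log q⁺)/2, (log q⁺)/2]` has `Re Q_{S_q}(g) < 0`, so RESCUE(q) has work to do. [cite: ConnesConsani2023, §2.2–2.4 (the semi-local forms «with and without» a prime); this track] -/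
theorem not_weilSemilocalPositivityOn_window_end_upto_thirteen :
    ¬ WeilSemilocalPositivityOn (Nat.primesBelow 2) (Real.log 3 / 2) ∧ ¬ WeilSemilocalPositivityOn (Nat.primesBelow 3) (Real.log 5 / 2) ∧
      ¬ WeilSemilocalPositivityOn (Nat.primesBelow 5) (Real.log 7 / 2) ∧ ¬ WeilSemilocalPositivityOn (Nat.primesBelow 7) (Real.log 11 / 2) ∧
        ¬ WeilSemilocalPositivityOn (Nat.primesBelow 11) (Real.log 13 / 2) ∧
          ¬ WeilSemilocalPositivityOn (Nat.primesBelow 13) (Real.log 17 / 2) := by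
  simp only [not_weilSemilocalPositivityOn_iff_weilSemilocalThreshold_lt]
  exact ⟨weilSemilocalThreshold_primesBelow_two_lt, weilSemilocalThreshold_primesBelow_three_lt,
    weilSemilocalThreshold_primesBelow_five_lt, weilSemilocalThreshold_primesBelow_seven_lt,
    weilSemilocalThreshold_primesBelow_eleven_lt, weilSemilocalThreshold_primesBelow_thirteen_lt⟩

/-- **Two-sided `δ*(3)`: `0 ≤ δ*(3) ≤ 223/400 − (log 3)/2`** (`< 0.0083`; DATA 0.0080 — the {2}-form's wall sits in a kernel-bounded sliver above
`(log 3)/2`). [this track; tree certificates] -/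
theorem wallOffset_three_mem_Icc : wallOffset 3 ∈ Icc (0 : ℝ) (223 / 400 - Real.log 3 / 2) := by
  refine ⟨wallOffset_three_nonneg, ?_⟩
  have h := weilSemilocalThreshold_two_le_05575
  push_cast at h
  rw [wallOffset, primesBelow_three]
  push_cast
  linarith

/-- **Two-sided `δ*(5)`: `0 ≤ δ*(5) ≤ 163/200 − (log 5)/2`** (`< 0.0103`; DATA 0.0025). [this track; tree certificates] -/
theorem wallOffset_five_mem_Icc : wallOffset 5 ∈ Icc (0 : ℝ) (163 / 200 - Real.log 5 / 2) := by
  refine ⟨wallOffset_five_nonneg, ?_⟩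
  have h := weilSemilocalThreshold_twoThree_le_0815
  push_cast at h
  rw [wallOffset, primesBelow_five]
  push_cast
  linarith

/-- `δ*(7) ≤ 197/200 − (log 7)/2` (`< 0.0121`; DATA 0.0012; the lower bound `0 ≤ δ*(7)` is `H(5)`, certified numerically, not a theorem). [this track; tree certificate] -/
theorem wallOffset_seven_le : wallOffset 7 ≤ 197 / 200 - Real.log 7 / 2 := by
  have h := weilSemilocalThreshold_twoThreeFive_le_0985
  push_cast at h
  rw [wallOffset, primesBelow_seven]
  push_cast
  linarith

/-- `δ*(11) ≤ 61/50 − (log 11)/2` (`< 0.0211`; DATA 5.4·10⁻⁴). [this track; tree certificate] -/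
theorem wallOffset_eleven_le : wallOffset 11 ≤ 61 / 50 - Real.log 11 / 2 := by
  have h := weilSemilocalThreshold_uptoSeven_le_122
  push_cast at h
  rw [wallOffset, primesBelow_eleven]
  push_cast
  linarith

/-- `δ*(13) ≤ 13/10 − (log 13)/2` (`< 0.0176`; DATA 4.3·10⁻⁴). [this track; tree certificate] -/
theorem wallOffset_thirteen_le : wallOffset 13 ≤ 13 / 10 - Real.log 13 / 2 := by
  have h := weilSemilocalThreshold_uptoEleven_le_130
  push_cast at h
  rw [wallOffset, primesBelow_thirteen]
  push_cast
  linarith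

end Summit.RiemannHypothesis.RiemannHypothesis.Theorems.HandoffUpperClauses

end
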